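import Literature.AnabelianGeometry.EtaleTheta.Discharge.Sec5OfBiKummerDataKummer

/-!
# [EtTh] §5 p. 331 (PDF p. 105): the uniqueness clause `SgpUnique` and the bi-Kummer rows at the GENUINE §5 data

Mochizuki, *The étale theta function and its Frobenioid-theoretic manifestations*, Publ. RIMS **45** (2009)
[cite: MochizukiEtTh2009, §5 p.331 (PDF p.105); Prop 4.3 (iii) p.317 (PDF p.91)].  abc-iut cell, block F (FACT-PROVING
wave), seat abc-iut-f-125 (tranche 125: FACT-LIST rows **F-0551** `ThetaFrobenioid.BiKummerDifferenceMem`, **F-0552**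
`SgpCapSpec`, **F-0553** `SgpCupSpec`, **F-0554** `SgpUnique`, trunk `FrobenioidThetaBiKummer.lean`).  PROOF-ONLY companion:
no `def`, no `Prop` fact, nothing landed is edited or restated; imports abc-iut-L2-t4's `Discharge/Sec5OfBiKummerDataKummer.lean`.

The four rows are `parametrised` predicates on the DATA-ONLY interface `𝔉 : ThetaFrobenioid C D`; their universal closures
are REFUTED and toy instance forms PROVED in abc-iut-w6-d043's `Discharge/Sec5BiKummerSchemaVerdicts.lean` (FACT-LIST rule R5:
such a row is consumed at NAMED instances).  This file supplies the instance forms AT THE GENUINE NAMED INSTANCES the cell's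
§5 constructions provide — the two constructors whose `s^⊓-gp_N, s^⊔-gp_N` ARE the "unique group homomorphisms" of p.331:
* `ThetaFrobenioid.ofRootData` (`FrobenioidThetaOfRootData.lean`: §5 data over abstract Frobenioid operations with the
  sections DEFINED as the unique lifts `liftAlong`), and
* `ThetaFrobenioid.ofBiKummerData` (`FrobenioidThetaOfBiKummerData.lean`: the §5 data ASSEMBLED from abc-iut-L2-t3's §4
  bi-Kummer setting, an `N`-th root `R` of the fraction-pair of an `l`-th root of `Θ̈`, and abc-iut-L2-t2's `ThetaEnvData`;
  this is the instance the kernel DAG index cites, e.g. `DAGXa` `…_ofBiKummerData`).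

WHAT IS PROVED.
* `sgpUnique_ofRootData` — **F-0554 at `ofRootData`**, from the THEOREMS `sgpCapSpec_ofRootData` / `sgpCupSpec_ofRootData`
  and abc-iut-L2-t4's `sgpUnique_of` (p.331 "determines unique group homomorphisms": uniqueness by total epimorphicity,
  [FrdI] Def. 1.3 / §0 — the constructor input `hepi`); UNCONDITIONAL on the two remaining named §5 facts of
  `facts_ofRootData` (`BiKummerDifferenceMem`, `ConstantsActByCyclotome`).
* `sgpUnique_ofBiKummerData` — **F-0554 at `ofBiKummerData`** (total epimorphicity of the model Frobenioid,
  `epi_of_model`, [FrdI] Thm. 5.2 via `ModelFrobenioid.Hypotheses`); no further input.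
* `sgpCap_mul_sgpCup_inv_mem_muTorsion_ofBiKummerData` — **F-0551 at `ofBiKummerData` in PRINT's orientation**
  (Prop. 4.3 (iii), kurims p.83 / PRIMS p.317: "the difference `s^⊓-gp_N · (s^⊔-gp_N)^{-1}` determines a twisted homomorphism
  `H_{B_N} → μ_N(B_N)`"), a one-line corollary of abc-iut-L2-t4's `biKummerDifferenceMem_ofBiKummerData` and
  `biKummerDifferenceMem_iff`; inputs exactly those of that theorem (`hσ` [FrdI] Prop. 5.6; `hH` `Π^tp_Ÿ ⊆ H_⊙`, p.322
  (PDF p.96); `hfrac`/`haut` the [FrdI] Thm. 5.2 (ii) dictionary laws of `toB`).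
* `biKummerRows_ofBiKummerData` — the **tranche-125 certificate**: `SgpCapSpec ∧ SgpCupSpec ∧ SgpUnique ∧ BiKummerDifferenceMem`
  at `ofBiKummerData`, i.e. all four rows F-0552/F-0553/F-0554/F-0551 are THEOREMS for the assembled genuine §5 data (the first
  two and the last by abc-iut-L2-t4's theorems, cited not restated; the third new here).
HONEST FRAMING: kernel-checked consequences for data so constructed, under the printed [FrdI]/§1–§4 inputs listed as
hypotheses; nothing of [EtTh] is asserted unconditionally; a FACT row is an assumption label, not an endorsement; nothing here
bears on [IUTchIII] Cor. 3.12 and no side is taken; typed ≠ proved.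
-/

noncomputable section

namespace Literature.AnabelianGeometry.EtaleTheta

open CategoryTheory Opposite Literature.AlgebraicGeometry.Frobenioids

universe u₀ v₀ u v w w' v' u' u''

namespace ThetaFrobenioid

/-! ### F-0554 `SgpUnique` at `ofRootData` -/

section RootData

variable {C : Type u'} [Category.{v'} C] {D : Type u''} [Category.{w'} D]
  (F : FrobenioidTheta.TemperedFrobenioidStub.{w} C D) (Q : FrobenioidTheta.ThetaSubquotientStub.{w} D)
  (l : ℕ) (odd_l : Odd l) (N : ℕ+) (T : ThetaEnvData.{v'} N) (Acirc AN BN : C) (sCap sCup : AN ⟶ BN)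
  (base_map_sCap : F.pre.base.map sCap = F.pre.base.map sCup)
  (isPreStep_sCap : F.pre.IsPreStep sCap) (isPreStep_sCup : F.pre.IsPreStep sCup)
  (ρ : T.PiX →* Aut (F.pre.base.obj BN)) (ρ_surjective : Function.Surjective ρ)
  (isOpen_ker_ρ : IsOpen (ρ.ker : Set T.PiX)) (σ : Aut (F.pre.base.obj AN) →* Aut AN)
  (K : Type w) [Field K] (constEmb : Kˣ →* F.biratUnits BN) (constEmb_injective : Function.Injective constEmb)
  (thetaFn : F.biratUnits Acirc)
  (hepi : ∀ ⦃X Y : C⦄ (f : X ⟶ Y), Epi f) (hiso : F.pre.IsOfIsotropicType)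
  (hiiid : ∀ ⦃A B B' : C⦄ (φ : A ⟶ B) (φ' : A ⟶ B'), F.pre.IsCoAngularPreStep φ →
    F.pre.IsCoAngularPreStep φ' → F.pre.div φ ∣ F.pre.div φ' →
      ∃ f : B ⟶ B', F.pre.IsCoAngularPreStep f ∧ φ ≫ f = φ')
  (hdivc : ∀ g : Aut (F.pre.base.obj BN),
    F.pre.div ((σ ((ofRootData.aux F Q l odd_l N T Acirc AN BN sCap sCup base_map_sCap isPreStep_sCap isPreStep_sCup ρ
      ρ_surjective isOpen_ker_ρ σ K constEmb constEmb_injective thetaFn).autBaseIsoAB.symm g)).hom ≫ sCap) = F.pre.div sCap)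
  (hdivp : ∀ h : (ofRootData.aux F Q l odd_l N T Acirc AN BN sCap sCup base_map_sCap isPreStep_sCap isPreStep_sCup ρ
      ρ_surjective isOpen_ker_ρ σ K constEmb constEmb_injective thetaFn).HB,
    F.pre.div ((σ ((ofRootData.aux F Q l odd_l N T Acirc AN BN sCap sCup base_map_sCap isPreStep_sCap isPreStep_sCup ρ
      ρ_surjective isOpen_ker_ρ σ K constEmb constEmb_injective thetaFn).autBaseIsoAB.symm h.1)).hom ≫ sCup) =
      F.pre.div sCup)

/-- **F-0554 `SgpUnique` is a THEOREM for `ofRootData`** (p.331 (PDF p.105): `s^trv_N` "determines unique group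
homomorphisms `s^⊓-gp_N : Aut_D(B_N^bs) → Aut_C(B_N)`; `s^⊔-gp_N : H_{B_N} → Aut_C(B_N)` such that …"): any pair of
homomorphisms satisfying the two printed defining relations equals `(s^⊓-gp_N, s^⊔-gp_N)` — because these data's sections
SATISFY the relations (`sgpCapSpec_ofRootData`, `sgpCupSpec_ofRootData`) and `s^⊓_N`, `s^⊔_N` are epimorphisms (every
morphism of a Frobenioid is, [FrdI] Def. 1.3; constructor input `hepi`), via abc-iut-L2-t4's `sgpUnique_of`.  Unconditional on
the remaining named §5 facts `BiKummerDifferenceMem`, `ConstantsActByCyclotome` of `facts_ofRootData`.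
[cite: MochizukiEtTh2009, §5 p.331 (PDF p.105)] -/
theorem sgpUnique_ofRootData :
    (ofRootData F Q l odd_l N T Acirc AN BN sCap sCup base_map_sCap isPreStep_sCap isPreStep_sCup ρ ρ_surjective
      isOpen_ker_ρ σ K constEmb constEmb_injective thetaFn hepi hiso hiiid hdivc hdivp).SgpUnique := by
  haveI : Epi (ofRootData F Q l odd_l N T Acirc AN BN sCap sCup base_map_sCap isPreStep_sCap isPreStep_sCup ρ ρ_surjective
      isOpen_ker_ρ σ K constEmb constEmb_injective thetaFn hepi hiso hiiid hdivc hdivp).sCap := hepi _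
  haveI : Epi (ofRootData F Q l odd_l N T Acirc AN BN sCap sCup base_map_sCap isPreStep_sCap isPreStep_sCup ρ ρ_surjective
      isOpen_ker_ρ σ K constEmb constEmb_injective thetaFn hepi hiso hiiid hdivc hdivp).sCup := hepi _
  exact sgpUnique_of _
    (sgpCapSpec_ofRootData F Q l odd_l N T Acirc AN BN sCap sCup base_map_sCap isPreStep_sCap isPreStep_sCup ρ
      ρ_surjective isOpen_ker_ρ σ K constEmb constEmb_injective thetaFn hepi hiso hiiid hdivc hdivp)
    (sgpCupSpec_ofRootData F Q l odd_l N T Acirc AN BN sCap sCup base_map_sCap isPreStep_sCap isPreStep_sCup ρ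
      ρ_surjective isOpen_ker_ρ σ K constEmb constEmb_injective thetaFn hepi hiso hiiid hdivc hdivp)

/-- The §5 p.331 sentence in full at `ofRootData`: the defining relations HOLD (F-0552, F-0553) AND the homomorphisms
satisfying them are unique (F-0554).  [cite: MochizukiEtTh2009, §5 p.331 (PDF p.105)] -/
theorem sgpSpecs_and_unique_ofRootData :
    (ofRootData F Q l odd_l N T Acirc AN BN sCap sCup base_map_sCap isPreStep_sCap isPreStep_sCup ρ ρ_surjective
      isOpen_ker_ρ σ K constEmb constEmb_injective thetaFn hepi hiso hiiid hdivc hdivp).SgpCapSpec ∧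
    (ofRootData F Q l odd_l N T Acirc AN BN sCap sCup base_map_sCap isPreStep_sCap isPreStep_sCup ρ ρ_surjective
      isOpen_ker_ρ σ K constEmb constEmb_injective thetaFn hepi hiso hiiid hdivc hdivp).SgpCupSpec ∧
    (ofRootData F Q l odd_l N T Acirc AN BN sCap sCup base_map_sCap isPreStep_sCap isPreStep_sCup ρ ρ_surjective
      isOpen_ker_ρ σ K constEmb constEmb_injective thetaFn hepi hiso hiiid hdivc hdivp).SgpUnique :=
  ⟨sgpCapSpec_ofRootData F Q l odd_l N T Acirc AN BN sCap sCup base_map_sCap isPreStep_sCap isPreStep_sCup ρ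
      ρ_surjective isOpen_ker_ρ σ K constEmb constEmb_injective thetaFn hepi hiso hiiid hdivc hdivp,
    sgpCupSpec_ofRootData F Q l odd_l N T Acirc AN BN sCap sCup base_map_sCap isPreStep_sCap isPreStep_sCup ρ
      ρ_surjective isOpen_ker_ρ σ K constEmb constEmb_injective thetaFn hepi hiso hiiid hdivc hdivp,
    sgpUnique_ofRootData F Q l odd_l N T Acirc AN BN sCap sCup base_map_sCap isPreStep_sCap isPreStep_sCup ρ
      ρ_surjective isOpen_ker_ρ σ K constEmb constEmb_injective thetaFn hepi hiso hiiid hdivc hdivp⟩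

end RootData

/-! ### F-0554 `SgpUnique` and F-0551 `BiKummerDifferenceMem` at the assembled data `ofBiKummerData` -/

section BiKummerData

variable {K : Type u₀} [Field K] {X : SemiGraphs.TemperedArithmeticGroup.{u₀} K} {D₀ : Type u₀} [Category.{v₀} D₀]
  {V : FrdIMonoidStub.{w}} {T₀ : RealifiedDivisorMonoids (D₀ := D₀) V} {D : Type u} [Category.{v} D]
  {VD : FrdICatStub.{u, v, w} D} {S : BiKummerSetting X T₀ D VD}
  {pullFrac : ∀ {A A' : S.C} (_ : A' ⟶ A), S.biratUnits A → S.biratUnits A'}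
  {lv N : ℕ+} {T : ThetaEnvData.{max v w} N} {θ : S.biratUnits S.Aodot} {Bl : S.C}
  {Pl : S.FractionPair θ Bl} {Rl : S.NthRoot θ Pl lv pullFrac}
  (h : ModelFrobenioid.Hypotheses S.tf.divisorMonoid S.tf.ratFnFunctor)
  (toB : ∀ A : S.C, S.biratUnits A →* S.tf.biratUnitsModel A) (Q : FrobenioidTheta.ThetaSubquotientStub.{w} D)
  (odd_l : Odd (lv : ℕ)) (R : S.NthRoot Rl.root Rl.pair N pullFrac) (ιX : T.PiX ≃ₜ* X.Pi)
  (hopen : IsOpen ((S.galoisSurj R.AN.base R.αData.isGalois).ker : Set X.Pi)) (σ : Aut R.AN.base →* Aut R.AN)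
  (K' : Type w) [Field K'] (constEmb : K'ˣ →* S.tf.biratUnitsModel R.BN)
  (constEmb_injective : Function.Injective constEmb)
  (hdivc : ∀ g : Aut R.BN.base,
    ModelFrobenioid.div ((σ ((BiKummerSetting.NthRoot.baseIso S R).conjAut.symm g)).hom ≫ R.pair.num) =
      ModelFrobenioid.div R.pair.num)
  (hdivp : ∀ y : T.PiYdd,
    ModelFrobenioid.div ((σ (S.galoisSurj R.AN.base R.αData.isGalois (ιX y.1))).hom ≫ R.pair.den) =
      ModelFrobenioid.div R.pair.den)

/-- **F-0554 `SgpUnique` is a THEOREM for the assembled §5 data `ofBiKummerData`** (p.331 (PDF p.105), "determines unique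
group homomorphisms"): total epimorphicity of the model Frobenioid ([FrdI] Thm. 5.2, `epi_of_model` from
`ModelFrobenioid.Hypotheses`) and the theorems `sgpCapSpec_ofBiKummerData` / `sgpCupSpec_ofBiKummerData`.
[cite: MochizukiEtTh2009, §5 p.331 (PDF p.105)] -/
theorem sgpUnique_ofBiKummerData :
    (ofBiKummerData h toB Q odd_l R ιX hopen σ K' constEmb constEmb_injective hdivc hdivp).SgpUnique := by
  delta ofBiKummerData
  apply sgpUnique_ofRootData

/-- **F-0551 in PRINT's orientation for `ofBiKummerData`** (Prop. 4.3 (iii), p.317 (PDF p.91): "the difference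
`s^⊓-gp_N · (s^⊔-gp_N)^{-1}` determines a twisted homomorphism `H_{B_N} → μ_N(B_N)`"): for every `h ∈ H_{B_N}`,
`s^⊓-gp_N(h) · s^⊔-gp_N(h)⁻¹ ∈ μ_N(B_N)` — abc-iut-L2-t4's `biKummerDifferenceMem_ofBiKummerData` read through
`biKummerDifferenceMem_iff`.  Inputs as there: `hσ` ([FrdI] Prop. 5.6), `hH` (`Π^tp_Ÿ ⊆ H_⊙`, p.322 (PDF p.96)), `hfrac`/`haut`
([FrdI] Thm. 5.2 (ii) dictionary laws of `toB`).  [cite: MochizukiEtTh2009, Prop 4.3 (iii) p.317 (PDF p.91); §5 p.331 (PDF p.105)] -/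
theorem sgpCap_mul_sgpCup_inv_mem_muTorsion_ofBiKummerData
    (hσ : ∀ g : Aut R.AN.base, ModelFrobenioid.baseMap (σ g).hom = g.hom)
    (hH : ∀ y : T.PiX, y ∈ T.PiYdd → ιX y ∈ S.Hodot)
    (hfrac : ∀ {A B : S.C} (s' s'' : A ⟶ B) (h' : S.IsPreStep s') (h'' : S.IsPreStep s'')
      (hb : PreFrobenioid.BaseEquivalent S.F s' s''),
      (toB A (S.fracOf s' s'' h' h'' hb) : S.tf.ratFnFunctor.obj (op A.base)) *
        ModelFrobenioid.unit s'' = ModelFrobenioid.unit s')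
    (haut : ∀ {A : S.C} (e : Aut A) (x : S.biratUnits A),
      (toB A (S.biratAut A e x) : S.tf.ratFnFunctor.obj (op A.base)) =
        pull S.tf.ratFnFunctor (ModelFrobenioid.baseMap e.inv) (toB A x : S.tf.ratFnFunctor.obj (op A.base)))
    (hh : (ofBiKummerData h toB Q odd_l R ιX hopen σ K' constEmb constEmb_injective hdivc hdivp).HB) :
    (ofBiKummerData h toB Q odd_l R ιX hopen σ K' constEmb constEmb_injective hdivc hdivp).sgpCap
        (hh : Aut ((ofBiKummerData h toB Q odd_l R ιX hopen σ K' constEmb constEmb_injective hdivc hdivp).base.obj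
          (ofBiKummerData h toB Q odd_l R ιX hopen σ K' constEmb constEmb_injective hdivc hdivp).BN)) *
      ((ofBiKummerData h toB Q odd_l R ιX hopen σ K' constEmb constEmb_injective hdivc hdivp).sgpCup hh)⁻¹ ∈
      (ofBiKummerData h toB Q odd_l R ιX hopen σ K' constEmb constEmb_injective hdivc hdivp).muTorsion
        (ofBiKummerData h toB Q odd_l R ιX hopen σ K' constEmb constEmb_injective hdivc hdivp).BN
        (ofBiKummerData h toB Q odd_l R ιX hopen σ K' constEmb constEmb_injective hdivc hdivp).N :=
  ((biKummerDifferenceMem_iff _).mp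
    (biKummerDifferenceMem_ofBiKummerData h toB Q odd_l R ιX hopen σ K' constEmb constEmb_injective hdivc hdivp hσ hH
      hfrac haut)) hh

/-- **Tranche-125 certificate at the GENUINE §5 data**: all four FACT-LIST rows of `FrobenioidThetaBiKummer.lean` p.331 —
F-0552 `SgpCapSpec`, F-0553 `SgpCupSpec`, F-0554 `SgpUnique`, F-0551 `BiKummerDifferenceMem` — are THEOREMS for the assembled
data `ofBiKummerData` (the first, second and fourth by abc-iut-L2-t4's `sgpCapSpec_ofBiKummerData`, `sgpCupSpec_ofBiKummerData`,
`biKummerDifferenceMem_ofBiKummerData`, cited not restated; the third by `sgpUnique_ofBiKummerData`).  Inputs: those of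
`biKummerDifferenceMem_ofBiKummerData` only.  [cite: MochizukiEtTh2009, §5 p.331 (PDF p.105); Prop 4.3 (iii) p.317 (PDF p.91)] -/
theorem biKummerRows_ofBiKummerData
    (hσ : ∀ g : Aut R.AN.base, ModelFrobenioid.baseMap (σ g).hom = g.hom)
    (hH : ∀ y : T.PiX, y ∈ T.PiYdd → ιX y ∈ S.Hodot)
    (hfrac : ∀ {A B : S.C} (s' s'' : A ⟶ B) (h' : S.IsPreStep s') (h'' : S.IsPreStep s'')
      (hb : PreFrobenioid.BaseEquivalent S.F s' s''),
      (toB A (S.fracOf s' s'' h' h'' hb) : S.tf.ratFnFunctor.obj (op A.base)) *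
        ModelFrobenioid.unit s'' = ModelFrobenioid.unit s')
    (haut : ∀ {A : S.C} (e : Aut A) (x : S.biratUnits A),
      (toB A (S.biratAut A e x) : S.tf.ratFnFunctor.obj (op A.base)) =
        pull S.tf.ratFnFunctor (ModelFrobenioid.baseMap e.inv) (toB A x : S.tf.ratFnFunctor.obj (op A.base))) :
    (ofBiKummerData h toB Q odd_l R ιX hopen σ K' constEmb constEmb_injective hdivc hdivp).SgpCapSpec ∧
    (ofBiKummerData h toB Q odd_l R ιX hopen σ K' constEmb constEmb_injective hdivc hdivp).SgpCupSpec ∧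
    (ofBiKummerData h toB Q odd_l R ιX hopen σ K' constEmb constEmb_injective hdivc hdivp).SgpUnique ∧
    (ofBiKummerData h toB Q odd_l R ιX hopen σ K' constEmb constEmb_injective hdivc hdivp).BiKummerDifferenceMem :=
  ⟨sgpCapSpec_ofBiKummerData h toB Q odd_l R ιX hopen σ K' constEmb constEmb_injective hdivc hdivp,
    sgpCupSpec_ofBiKummerData h toB Q odd_l R ιX hopen σ K' constEmb constEmb_injective hdivc hdivp,
    sgpUnique_ofBiKummerData h toB Q odd_l R ιX hopen σ K' constEmb constEmb_injective hdivc hdivp,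
    biKummerDifferenceMem_ofBiKummerData h toB Q odd_l R ιX hopen σ K' constEmb constEmb_injective hdivc hdivp hσ hH
      hfrac haut⟩

end BiKummerData

end ThetaFrobenioid

end Literature.AnabelianGeometry.EtaleTheta

end
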